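import Summits.PneNP.PneNP.Theorems.ChebyshevTracialDesignSpectralNonTightness
import Summits.PneNP.PneNP.Theorems.ChebyshevTracialDesignTightFreeSpectral
import Summits.PneNP.PneNP.Theorems.ChebyshevTracialDesignRungCells
import Summits.PneNP.PneNP.Theorems.ChebyshevTracialDesignAPrioriBounds
import HarnessLib

/-!
# Cell pnp-psdrank, route `ChebyshevTracialDesign`: GLOBAL MISALIGNMENT — for every tight-orthogonal psd rectangle of every
# dimension, the averaged cut operator and the averaged matching operator are nearly orthogonal (crux `TracialDecayExp20`, stmt-PneNP-19878)

Brick 36 (prover g9). The Hilbert–Schmidt (matrix-valued) form of the tree's σ₂ brick (`…TightFreeSpectral.tightFree_card_mul_card_le`: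
a tight-free 0/1 rectangle of `t`-cuts × perfect matchings has `μν ≤ Λ/λ₀ ≤ 1/n`). For matrix-valued `X : OddSet n → M_r(ℝ)`,
`Y : PMatch n → M_r(ℝ)` that are tight on the `t`-cuts (`tr(X_U Y_M) = 0` whenever `|U| = t = 2c'+1 ≤ n/2` and `cc(U,M) = 1`):

  `tr((Σ_{|U|=t} X_U)(Σ_M Y_M)) ≤ √(C(n,t)·|PM_n|/n · Σ_{|U|=t} ‖X_U‖_F² · Σ_M ‖Y_M‖_F²)`        (`trace_sum_mul_sum_le`),

hence for a tight-orthogonal psd rectangle (`IsPsdRect`, where `‖X_U‖_F² ≤ tr X_U`) the AVERAGED operators `X̄ = E_U X_U`, `Ȳ = E_M Y_M` satisfy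

  `tr(X̄ Ȳ)/r ≤ √(τ_X · τ_Y / n)`      (`avg_overlap_le`; `τ_X = E_U tr X_U / r`, `τ_Y = E_M tr Y_M / r` the trace densities),

against the trivial `tr(X̄ Ȳ)/r ≤ min(τ_X, τ_Y)`: a gain of `√n` at equal densities, uniform in the dimension `r`. For `r = 1` and 0/1 rectangles this is
`μν ≤ √(μν/n)`, i.e. the σ₂ brick `μν ≤ 1/n`; for strategies isotropic on average (`X̄ = α I`, `Ȳ = β I`) it reads `αβ ≤ 1/n` (`isotropic_densities_le`).
Proof (§1–§2): entry by entry, split `U ↦ (X_U)_{pq}` on the `t`-sets into its mean and a mean-zero part; the tight incidence `A(U,M) = 1[cc = 1]`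
has a Johnson class-function Gram kernel (`exists_tightGram_classFunction`), constant column sums `N₁` (`level_colSum_eq`), odd ladder eigenvalues `0`
(`kernelEigen_tight_eq_zero_of_odd`) and even ones `≤ λ₀·Π_{i<κ'}(2i+1)/(n−2i) ≤ λ₀/n` (`kernelEigen_tight_even_le_prod`, `atten_mono`), so
`‖Aᵀ f‖² ≤ (λ₀/n)‖f‖²` off the constants (`JohnsonSpectrum.sum_sq_gram_le_of_sum_eq_zero`); tightness `Σ_{pq} Σ_{U,M} A (X_U)_{pq} (Y_M)_{qp} = 0`
then pits the constant term `N₁·tr(SX·SY)/C(n,t)` against a Cauchy–Schwarz-bounded remainder, and `C(n,t)λ₀ = |PM|N₁²` (`choose_mul_kernelEigen_zero_tight`).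
[cite: BrouwerHaemers2012, Prop. 4.3.2 (PDF p. 83)] [cite: GodsilMeagher2015, §15.2] [cite: Rothvoss2017, §2 (PDF p. 6)]
Stature: support/instrument (the first inequality in the tree that uses tightness on a GENERAL psd strategy of arbitrary dimension). WHAT THIS IS
NOT: no bound on the design VALUE (the value lives on the rare levels `3 ≤ c ≤ Tq n`, not on the constant mode), nothing on psd rank, no P-vs-NP content.
-/

set_option linter.dupNamespace false -- `Summit.PneNP.PneNP.…`: summit = sub-problem (D-0017)

noncomputable section

namespace Summit.PneNP.PneNP.Theorems.ChebyshevTracialDesignGlobalMisalignment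

open scoped Classical

open Finset Matrix Literature.Barriers.PneNP Literature.Combinatorics.Optimization
open Literature.Combinatorics.AssociationSchemes Literature.Combinatorics.AssociationSchemes.JohnsonHarmonics
open Literature.Combinatorics.AssociationSchemes.JohnsonSpectrum
open Summit.PneNP.PneNP.Theorems.ChebyshevTracialDesignTightColumnSums (cc_eq_card_filter_partner sum_oddSet_eq_sum_powersetCard
  sum_tight_oddSet_eq)
open Summit.PneNP.PneNP.Theorems.ChebyshevTracialDesignTightFreeSpectral (exists_tightGram_classFunction)
open Summit.PneNP.PneNP.Theorems.ChebyshevTracialDesignTightOddLayers (kernelEigen_tight_eq_zero_of_odd)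
open Summit.PneNP.PneNP.Theorems.ChebyshevTracialDesignTightEvenProduct (kernelEigen_tight_even_le_prod)
open Summit.PneNP.PneNP.Theorems.ChebyshevTracialDesignSpectralNonTightnessLayers (choose_mul_kernelEigen_zero_tight)
open Summit.PneNP.PneNP.Theorems.ChebyshevTracialDesignSpectralNonTightnessEstimates (atten_mono atten_nonneg)
open Summit.PneNP.PneNP.Theorems.ChebyshevTracialDesignLevelAttenuation (level_colSum_eq)
open Summit.PneNP.PneNP.Theorems.ChebyshevTracialDesignRungCells (card_tcuts_eq_choose)
open Summit.PneNP.PneNP.Theorems.ChebyshevTracialDesignProfilePolynomial (card_pmatch_pos)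
open Summit.PneNP.PneNP.Theorems.ChebyshevTracialDesignAPrioriBounds (trace_mul_le_trace_left)

variable {n : ℕ}

/-! ### §1 One scalar function against the tight incidence: mean part plus a spectrally small remainder -/

/-- The second-eigenvalue bound of the tight incidence on the `t`-cuts, `t = 2c'+1 ≤ n/2`: every ladder eigenvalue off the constants is
`≤ λ₀/n`, `λ₀ = kernelEigen n t 0 κ`. [cite: GodsilMeagher2015, §15.2] [cite: BrouwerHaemers2012, Prop. 4.3.2 (PDF p. 83)] -/
theorem kernelEigen_tight_le_div {c' : ℕ} (hn : Even n) (ht : 2 * (2 * c' + 1) ≤ n) (κ : ℕ → ℝ)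
    (hA : ∀ U ∈ univ.powersetCard (2 * c' + 1), ∀ U' ∈ univ.powersetCard (2 * c' + 1),
      ∑ M : PMatch n, (if (U.filter fun x => M.2.partner x ∉ U).card = 1 then (1 : ℝ) else 0) *
        (if (U'.filter fun x => M.2.partner x ∉ U').card = 1 then (1 : ℝ) else 0) = κ (U ∩ U').card)
    {j : ℕ} (hj1 : 1 ≤ j) (hjt : j ≤ 2 * c' + 1) :
    kernelEigen n (2 * c' + 1) j κ ≤ kernelEigen n (2 * c' + 1) 0 κ / n := by
  have hl0 := choose_mul_kernelEigen_zero_tight ht κ hA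
  have hCpos : (0 : ℝ) < (n.choose (2 * c' + 1) : ℝ) := by exact_mod_cast Nat.choose_pos (by omega)
  have hl00 : 0 ≤ kernelEigen n (2 * c' + 1) 0 κ := by
    have h : 0 ≤ (n.choose (2 * c' + 1) : ℝ) * kernelEigen n (2 * c' + 1) 0 κ := by rw [hl0]; positivity
    rw [mul_comm] at h
    exact nonneg_of_mul_nonneg_left h hCpos
  rcases Nat.even_or_odd j with ⟨κ', hκ'⟩ | hodd
  · have h2 : j = 2 * κ' := by omega
    have hκ'1 : 1 ≤ κ' := by omega
    have hκ'c : κ' ≤ c' := by omega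
    rw [h2]
    have hprod := kernelEigen_tight_even_le_prod hn ht hκ'c κ hA
    have hmono := atten_mono (n := n) hκ'1 (by omega : 4 * κ' ≤ n + 3)
    have h1 : ∏ i ∈ range 1, ((2 * i + 1 : ℝ) / ((n : ℝ) - 2 * i)) = 1 / n := by simp
    rw [h1] at hmono
    calc kernelEigen n (2 * c' + 1) (2 * κ') κ
        ≤ kernelEigen n (2 * c' + 1) 0 κ * ∏ i ∈ range κ', ((2 * i + 1 : ℝ) / ((n : ℝ) - 2 * i)) := hprod
      _ ≤ kernelEigen n (2 * c' + 1) 0 κ * (1 / n) := mul_le_mul_of_nonneg_left hmono hl00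
      _ = kernelEigen n (2 * c' + 1) 0 κ / n := by rw [mul_one_div]
  · rw [kernelEigen_tight_eq_zero_of_odd ⟨c', rfl⟩ ht hjt hodd κ hA]
    exact div_nonneg hl00 (Nat.cast_nonneg n)

/-- **Mean part plus remainder.** For `t = 2c'+1 ≤ n/2` (`n` even) and ANY `φ` on the subsets of `[n]`: against the tight incidence
`A(S,M) = 1[#\{x ∈ S : partner_M(x) ∉ S\} = 1]`, `Σ_{|S|=t} φ(S) A(S,M) = (Σ_{|S|=t} φ(S))/C(n,t) · N₁ + h(M)` with
`Σ_M h(M)² ≤ |PM_n|·N₁²/(n·C(n,t)) · Σ_{|S|=t} φ(S)²` (constant column sums `N₁`; second eigenvalue `≤ λ₀/n`).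
[cite: BrouwerHaemers2012, Prop. 4.3.2 (PDF p. 83)] -/
theorem tight_pairing_split {c' : ℕ} (hn : Even n) (ht : 2 * (2 * c' + 1) ≤ n) (φ : Finset (Fin n) → ℝ) :
    ∃ h : PMatch n → ℝ,
      (∑ M, h M ^ 2 ≤ (Fintype.card (PMatch n) : ℝ) * ((((n / 2).choose (1 + c') * (1 + c').choose c' * 2 ^ 1 : ℕ) : ℝ)) ^ 2 /
          ((n : ℝ) * (n.choose (2 * c' + 1) : ℝ)) * ∑ S ∈ univ.powersetCard (2 * c' + 1), φ S ^ 2) ∧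
      ∀ M : PMatch n, ∑ S ∈ univ.powersetCard (2 * c' + 1), φ S * (if (S.filter fun x => M.2.partner x ∉ S).card = 1 then (1 : ℝ) else 0) =
        (∑ S ∈ univ.powersetCard (2 * c' + 1), φ S) / (n.choose (2 * c' + 1) : ℝ) *
            ((((n / 2).choose (1 + c') * (1 + c').choose c' * 2 ^ 1 : ℕ) : ℝ)) + h M := by
  set Cn : ℝ := (n.choose (2 * c' + 1) : ℝ) with hCn
  set N1 : ℝ := ((((n / 2).choose (1 + c') * (1 + c').choose c' * 2 ^ 1 : ℕ) : ℝ)) with hN1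
  set m : ℝ := (∑ S ∈ univ.powersetCard (2 * c' + 1), φ S) / Cn with hm
  set φ0 : Finset (Fin n) → ℝ := fun S => if S.card = 2 * c' + 1 then φ S - m else 0 with hφ0
  set A : Finset (Fin n) → PMatch n → ℝ :=
    fun S M => if (S.filter fun x => M.2.partner x ∉ S).card = 1 then (1 : ℝ) else 0 with hAdef
  have hCpos : 0 < Cn := by rw [hCn]; exact_mod_cast Nat.choose_pos (by omega)
  have hcardC : (((univ : Finset (Fin n)).powersetCard (2 * c' + 1)).card : ℝ) = Cn := by
    rw [card_powersetCard, card_univ, Fintype.card_fin]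
  have hsumφ : ∑ S ∈ univ.powersetCard (2 * c' + 1), φ S = m * Cn := by rw [hm]; field_simp
  have hφ0_on : ∀ S ∈ (univ : Finset (Fin n)).powersetCard (2 * c' + 1), φ0 S = φ S - m := fun S hS => by
    rw [hφ0]; dsimp only; rw [if_pos (mem_powersetCard.1 hS).2]
  refine ⟨fun M => ∑ S ∈ univ.powersetCard (2 * c' + 1), φ0 S * A S M, ?_, fun M => ?_⟩
  · -- spectral bound on the mean-zero part
    obtain ⟨κ, hκ⟩ := exists_tightGram_classFunction (n := n) (t := 2 * c' + 1) ⟨c', rfl⟩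
    have hhom : IsHomog (2 * c' + 1) φ0 := fun S hS => by rw [hφ0]; dsimp only; rw [if_neg hS]
    have hsum0 : ∑ S ∈ univ.powersetCard (2 * c' + 1), φ0 S = 0 := by
      rw [sum_congr rfl hφ0_on, sum_sub_distrib, sum_const, nsmul_eq_mul, hcardC, hsumφ]; ring
    have hΛ : ∀ j, 1 ≤ j → j ≤ 2 * c' + 1 → kernelEigen n (2 * c' + 1) j κ ≤ kernelEigen n (2 * c' + 1) 0 κ / n :=
      fun j hj1 hjt => kernelEigen_tight_le_div hn ht κ hκ hj1 hjt
    have hgram := sum_sq_gram_le_of_sum_eq_zero (by omega : 2 * (2 * c' + 1) ≤ n + 1) A κ hκ hhom hsum0 hΛ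
    have hl0 := choose_mul_kernelEigen_zero_tight ht κ hκ
    have hk : kernelEigen n (2 * c' + 1) 0 κ = (Fintype.card (PMatch n) : ℝ) * N1 ^ 2 / Cn := by
      rw [eq_div_iff hCpos.ne', mul_comm]; exact hl0
    have hvar : ∑ S ∈ univ.powersetCard (2 * c' + 1), φ0 S ^ 2 ≤ ∑ S ∈ univ.powersetCard (2 * c' + 1), φ S ^ 2 := by
      have e : ∀ S ∈ (univ : Finset (Fin n)).powersetCard (2 * c' + 1), φ0 S ^ 2 = φ S ^ 2 - 2 * m * φ S + m ^ 2 :=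
        fun S hS => by rw [hφ0_on S hS]; ring
      rw [sum_congr rfl e, sum_add_distrib, sum_sub_distrib, ← mul_sum, sum_const, nsmul_eq_mul, hcardC, hsumφ]
      nlinarith [sq_nonneg m, hCpos]
    have hkn : 0 ≤ kernelEigen n (2 * c' + 1) 0 κ / n := by rw [hk]; positivity
    calc ∑ M, (∑ S ∈ univ.powersetCard (2 * c' + 1), φ0 S * A S M) ^ 2
        ≤ kernelEigen n (2 * c' + 1) 0 κ / n * ∑ S ∈ univ.powersetCard (2 * c' + 1), φ0 S ^ 2 := hgram
      _ ≤ kernelEigen n (2 * c' + 1) 0 κ / n * ∑ S ∈ univ.powersetCard (2 * c' + 1), φ S ^ 2 := mul_le_mul_of_nonneg_left hvar hkn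
      _ = (Fintype.card (PMatch n) : ℝ) * N1 ^ 2 / ((n : ℝ) * Cn) * ∑ S ∈ univ.powersetCard (2 * c' + 1), φ S ^ 2 := by
          rw [hk, div_div, mul_comm Cn]
  · -- pointwise identity: `φ = m + φ0` on the `t`-sets, and the column sum of `A` is `N₁`
    have hcol : ∑ S ∈ univ.powersetCard (2 * c' + 1), A S M = N1 := by
      rw [hAdef, hN1]; exact level_colSum_eq (r := 1) (e := c') ⟨0, rfl⟩ (by omega) M
    have e : ∀ S ∈ (univ : Finset (Fin n)).powersetCard (2 * c' + 1), φ S * A S M = m * A S M + φ0 S * A S M :=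
      fun S hS => by rw [hφ0_on S hS]; ring
    rw [sum_congr rfl e, sum_add_distrib, ← mul_sum, hcol]

/-! ### §2 The Hilbert–Schmidt mixing inequality for tight matrix-valued pairs -/

/-- Entries of a product: `tr(X Y) = Σ_{p,q} X_{pq} Y_{qp}`. -/
theorem trace_mul_eq_sum {r : ℕ} (X Y : Matrix (Fin r) (Fin r) ℝ) : (X * Y).trace = ∑ p, ∑ q, X p q * Y q p := by
  simp only [trace, diag_apply, mul_apply]

/-- Cauchy–Schwarz in square-root form over a finite type. -/
theorem sum_mul_le_sqrt_mul_sqrt {ι : Type*} [Fintype ι] (f g : ι → ℝ) :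
    ∑ i, f i * g i ≤ Real.sqrt (∑ i, f i ^ 2) * Real.sqrt (∑ i, g i ^ 2) := by
  rw [← Real.sqrt_mul (sum_nonneg fun i _ => sq_nonneg (f i))]
  exact (le_abs_self _).trans (Real.abs_le_sqrt (sum_mul_sq_le_sq_mul_sq univ f g))

/-- **Hilbert–Schmidt mixing inequality.** Let `n` be even, `t = 2c'+1` with `2t ≤ n`, and let `X : OddSet n → M_r(ℝ)`, `Y : PMatch n → M_r(ℝ)`
be tight on the `t`-cuts: `tr(X_U Y_M) = 0` whenever `|U| = t` and `cc(U,M) = 1`. Then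
`tr((Σ_{|U|=t} X_U)(Σ_M Y_M)) ≤ √(C(n,t)·|PM_n|/n · (Σ_{|U|=t} Σ_{pq} X_U[p,q]²) · (Σ_M Σ_{pq} Y_M[p,q]²))`.
[cite: BrouwerHaemers2012, Prop. 4.3.2 (PDF p. 83)] [cite: GodsilMeagher2015, §15.2] -/
theorem trace_sum_mul_sum_le {r c' : ℕ} (hn : Even n) (ht : 2 * (2 * c' + 1) ≤ n)
    (X : OddSet n → Matrix (Fin r) (Fin r) ℝ) (Y : PMatch n → Matrix (Fin r) (Fin r) ℝ)
    (htight : ∀ (U : OddSet n) (M : PMatch n), U.1.card = 2 * c' + 1 → cc U M = 1 → (X U * Y M).trace = 0) :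
    ((∑ U ∈ univ.filter (fun U : OddSet n => U.1.card = 2 * c' + 1), X U) * ∑ M, Y M).trace ≤
      Real.sqrt ((n.choose (2 * c' + 1) : ℝ) * (Fintype.card (PMatch n) : ℝ) / n *
        ((∑ U ∈ univ.filter (fun U : OddSet n => U.1.card = 2 * c' + 1), ∑ p, ∑ q, X U p q ^ 2) *
          ∑ M, ∑ p, ∑ q, Y M p q ^ 2)) := by
  set T : Finset (OddSet n) := univ.filter (fun U : OddSet n => U.1.card = 2 * c' + 1) with hT
  set Cn : ℝ := (n.choose (2 * c' + 1) : ℝ) with hCn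
  set PM : ℝ := (Fintype.card (PMatch n) : ℝ) with hPM
  set N1 : ℝ := ((((n / 2).choose (1 + c') * (1 + c').choose c' * 2 ^ 1 : ℕ) : ℝ)) with hN1
  have hCpos : 0 < Cn := by rw [hCn]; exact_mod_cast Nat.choose_pos (by omega)
  have hPMpos : 0 < PM := by rw [hPM]; exact_mod_cast card_pmatch_pos hn
  have hN1pos : 0 < N1 := by
    rw [hN1]; push_cast
    have h1 : 0 < (n / 2).choose (1 + c') := Nat.choose_pos (by omega)
    have h2 : 0 < (1 + c').choose c' := Nat.choose_pos (by omega)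
    positivity
  -- the entry functions on subsets of `[n]`
  set φ : Fin r × Fin r → Finset (Fin n) → ℝ := fun pq S => if hS : Odd S.card then X ⟨S, hS⟩ pq.1 pq.2 else 0 with hφ
  have hφU : ∀ (pq : Fin r × Fin r) (U : OddSet n), φ pq U.1 = X U pq.1 pq.2 := fun pq U => by
    rw [hφ]; dsimp only; rw [dif_pos U.2]
  -- re-indexing `t`-cuts ↔ `t`-subsets
  have hreindex : ∀ F : Finset (Fin n) → ℝ, ∑ U ∈ T, F U.1 = ∑ S ∈ univ.powersetCard (2 * c' + 1), F S := by
    intro F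
    have h := sum_oddSet_eq_sum_powersetCard (n := n) (t := 2 * c' + 1) ⟨c', rfl⟩ (fun _ => True) F
    rw [filter_true_of_mem (fun _ _ => trivial)] at h
    rw [← h, hT]
    exact sum_congr (filter_congr fun U _ => by simp) fun _ _ => rfl
  -- split every entry function
  choose h hh hsplit using fun pq : Fin r × Fin r => tight_pairing_split hn ht (φ pq)
  -- abbreviations for the entrywise sums
  set SXf : Fin r × Fin r → ℝ := fun pq => ∑ S ∈ univ.powersetCard (2 * c' + 1), φ pq S with hSXf
  set SY : Fin r × Fin r → ℝ := fun pq => ∑ M, Y M pq.2 pq.1 with hSY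
  set K : ℝ := PM * N1 ^ 2 / ((n : ℝ) * Cn) with hK
  -- (a) tightness, entry-summed, on each column `M`
  have htight' : ∀ M : PMatch n, ∑ S ∈ univ.powersetCard (2 * c' + 1),
      (∑ pq : Fin r × Fin r, φ pq S * Y M pq.2 pq.1) *
        (if (S.filter fun x => M.2.partner x ∉ S).card = 1 then (1 : ℝ) else 0) = 0 := by
    intro M
    have hite : ∀ S : Finset (Fin n), (∑ pq : Fin r × Fin r, φ pq S * Y M pq.2 pq.1) *
        (if (S.filter fun x => M.2.partner x ∉ S).card = 1 then (1 : ℝ) else 0) =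
        if (S.filter fun x => M.2.partner x ∉ S).card = 1 then ∑ pq : Fin r × Fin r, φ pq S * Y M pq.2 pq.1 else 0 := by
      intro S; split_ifs <;> simp
    rw [sum_congr rfl (fun S _ => hite S), ← sum_filter,
      ← sum_tight_oddSet_eq M ⟨c', rfl⟩ (fun S => ∑ pq : Fin r × Fin r, φ pq S * Y M pq.2 pq.1)]
    refine sum_eq_zero fun U hU => ?_
    have hU' := (mem_filter.1 hU).2
    have h0 := htight U M hU'.1 hU'.2
    rw [trace_mul_eq_sum] at h0
    rw [Fintype.sum_prod_type]
    simpa only [hφU] using h0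
  -- (b) summing `Y_M[q,p] ×` the split over all entries and columns gives zero
  have hzero : ∑ M, ∑ pq : Fin r × Fin r, Y M pq.2 pq.1 * (SXf pq / Cn * N1 + h pq M) = 0 := by
    refine sum_eq_zero fun M _ => ?_
    have e : ∀ pq : Fin r × Fin r, Y M pq.2 pq.1 * (SXf pq / Cn * N1 + h pq M) =
        ∑ S ∈ univ.powersetCard (2 * c' + 1), Y M pq.2 pq.1 *
          (φ pq S * (if (S.filter fun x => M.2.partner x ∉ S).card = 1 then (1 : ℝ) else 0)) := fun pq => by
      rw [← mul_sum, hsplit pq M, hSXf, hCn]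
    rw [sum_congr rfl (fun pq _ => e pq), sum_comm]
    refine (sum_congr rfl fun S _ => ?_).trans (htight' M)
    rw [sum_mul]
    exact sum_congr rfl fun pq _ => by ring
  -- (c) the trace of the product of the sums, entrywise
  have htr : ((∑ U ∈ T, X U) * ∑ M, Y M).trace = ∑ pq : Fin r × Fin r, SXf pq * SY pq := by
    rw [trace_mul_eq_sum, Fintype.sum_prod_type]
    refine sum_congr rfl fun p _ => sum_congr rfl fun q _ => ?_
    rw [Matrix.sum_apply, Matrix.sum_apply, hSXf, hSY]
    dsimp only
    rw [← hreindex (φ (p, q))]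
    exact congrArg₂ (· * ·) (sum_congr rfl fun U _ => (hφU (p, q) U).symm) rfl
  -- (d) the key identity: `(N₁/C) · tr(SX·SY) = − Σ_M Σ_pq Y_M[q,p] h_pq(M)`
  have hkey : N1 / Cn * ((∑ U ∈ T, X U) * ∑ M, Y M).trace = -∑ M, ∑ pq : Fin r × Fin r, Y M pq.2 pq.1 * h pq M := by
    have e : ∀ (M : PMatch n) (pq : Fin r × Fin r), Y M pq.2 pq.1 * (SXf pq / Cn * N1 + h pq M) =
        N1 / Cn * (SXf pq * Y M pq.2 pq.1) + Y M pq.2 pq.1 * h pq M := fun M pq => by ring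
    simp only [e, sum_add_distrib, ← mul_sum] at hzero
    have hswap : ∑ M, ∑ pq : Fin r × Fin r, SXf pq * Y M pq.2 pq.1 = ∑ pq : Fin r × Fin r, SXf pq * SY pq := by
      rw [sum_comm]
      exact sum_congr rfl fun pq _ => by rw [hSY]; dsimp only; rw [mul_sum]
    rw [hswap] at hzero
    rw [htr]
    linarith
  -- (e) Cauchy–Schwarz on the remainder
  have hX2 : ∑ pq : Fin r × Fin r, ∑ S ∈ univ.powersetCard (2 * c' + 1), φ pq S ^ 2 = ∑ U ∈ T, ∑ p, ∑ q, X U p q ^ 2 := by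
    calc ∑ pq : Fin r × Fin r, ∑ S ∈ univ.powersetCard (2 * c' + 1), φ pq S ^ 2
        = ∑ S ∈ univ.powersetCard (2 * c' + 1), ∑ pq : Fin r × Fin r, φ pq S ^ 2 := sum_comm
      _ = ∑ U ∈ T, ∑ pq : Fin r × Fin r, φ pq U.1 ^ 2 := (hreindex (fun S => ∑ pq : Fin r × Fin r, φ pq S ^ 2)).symm
      _ = ∑ U ∈ T, ∑ p, ∑ q, X U p q ^ 2 := sum_congr rfl fun U _ => by
          rw [Fintype.sum_prod_type]; simp only [hφU]
  have hrem : -∑ M, ∑ pq : Fin r × Fin r, Y M pq.2 pq.1 * h pq M ≤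
      Real.sqrt (∑ M, ∑ p, ∑ q, Y M p q ^ 2) * Real.sqrt (K * ∑ U ∈ T, ∑ p, ∑ q, X U p q ^ 2) := by
    have hcs := sum_mul_le_sqrt_mul_sqrt (ι := PMatch n × (Fin r × Fin r)) (fun z => -Y z.1 z.2.2 z.2.1) (fun z => h z.2 z.1)
    rw [Fintype.sum_prod_type, Fintype.sum_prod_type, Fintype.sum_prod_type] at hcs
    have e1 : ∑ M, ∑ pq : Fin r × Fin r, -Y M pq.2 pq.1 * h pq M = -∑ M, ∑ pq : Fin r × Fin r, Y M pq.2 pq.1 * h pq M := by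
      simp only [neg_mul, sum_neg_distrib]
    have e2 : ∑ M, ∑ pq : Fin r × Fin r, (-Y M pq.2 pq.1) ^ 2 = ∑ M, ∑ p, ∑ q, Y M p q ^ 2 := by
      refine sum_congr rfl fun M _ => ?_
      rw [Fintype.sum_prod_type, sum_comm]
      exact sum_congr rfl fun q _ => sum_congr rfl fun p _ => by ring
    have e3 : ∑ M, ∑ pq : Fin r × Fin r, h pq M ^ 2 ≤ K * ∑ U ∈ T, ∑ p, ∑ q, X U p q ^ 2 := by
      rw [sum_comm, ← hX2, mul_sum]
      exact sum_le_sum fun pq _ => by rw [hK, hPM, hN1, hCn]; exact hh pq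
    rw [e1, e2] at hcs
    refine hcs.trans (mul_le_mul_of_nonneg_left (Real.sqrt_le_sqrt e3) (Real.sqrt_nonneg _))
  -- (f) divide by `N₁/C` and simplify the constant
  have hfin : ((∑ U ∈ T, X U) * ∑ M, Y M).trace ≤
      Cn / N1 * (Real.sqrt (∑ M, ∑ p, ∑ q, Y M p q ^ 2) * Real.sqrt (K * ∑ U ∈ T, ∑ p, ∑ q, X U p q ^ 2)) := by
    have h1 : N1 / Cn * ((∑ U ∈ T, X U) * ∑ M, Y M).trace ≤
        Real.sqrt (∑ M, ∑ p, ∑ q, Y M p q ^ 2) * Real.sqrt (K * ∑ U ∈ T, ∑ p, ∑ q, X U p q ^ 2) := by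
      rw [hkey]; exact hrem
    calc ((∑ U ∈ T, X U) * ∑ M, Y M).trace = Cn / N1 * (N1 / Cn * ((∑ U ∈ T, X U) * ∑ M, Y M).trace) := by
          field_simp
      _ ≤ _ := mul_le_mul_of_nonneg_left h1 (div_pos hCpos hN1pos).le
  refine hfin.trans (le_of_eq ?_)
  have hsq : Cn / N1 = Real.sqrt ((Cn / N1) ^ 2) := (Real.sqrt_sq (div_pos hCpos hN1pos).le).symm
  rw [hsq, ← Real.sqrt_mul (sum_nonneg fun M _ => sum_nonneg fun p _ => sum_nonneg fun q _ => sq_nonneg _),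
    ← Real.sqrt_mul (sq_nonneg _)]
  congr 1
  rw [hK]
  field_simp

/-! ### §3 Tight-orthogonal psd rectangles: the averaged operators are nearly orthogonal -/

/-- For a contraction `0 ⪯ X ⪯ I`: `Σ_{pq} X[p,q]² = tr(X²) ≤ tr X`. -/
theorem sum_sq_le_trace {r : ℕ} {X : Matrix (Fin r) (Fin r) ℝ} (h0 : X.PosSemidef) (h1 : (1 - X).PosSemidef) :
    ∑ p, ∑ q, X p q ^ 2 ≤ X.trace := by
  have hsym : ∀ p q, X q p = X p q := fun p q => by
    have h := h0.1.apply p q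
    rwa [star_trivial] at h
  calc ∑ p, ∑ q, X p q ^ 2 = ∑ p, ∑ q, X p q * X q p :=
        sum_congr rfl fun p _ => sum_congr rfl fun q _ => by rw [hsym p q, sq]
    _ = (X * X).trace := (trace_mul_eq_sum X X).symm
    _ ≤ X.trace := trace_mul_le_trace_left h0 h1

/-- **Global misalignment, trace form.** For `n` even, `t = 2c'+1 ≤ n/2` and a tight-orthogonal psd rectangle `(X, Y)` of ANY dimension `r`:
`tr((Σ_{|U|=t} X_U)(Σ_M Y_M)) ≤ √(C(n,t)·|PM_n|/n · (Σ_{|U|=t} tr X_U) · (Σ_M tr Y_M))`.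
[cite: BrouwerHaemers2012, Prop. 4.3.2 (PDF p. 83)] [cite: Rothvoss2017, §2 (PDF p. 6)] -/
theorem trace_sum_mul_sum_le_of_isPsdRect {r c' : ℕ} (hn : Even n) (ht : 2 * (2 * c' + 1) ≤ n)
    {X : OddSet n → Matrix (Fin r) (Fin r) ℝ} {Y : PMatch n → Matrix (Fin r) (Fin r) ℝ} (hXY : IsPsdRect X Y) :
    ((∑ U ∈ univ.filter (fun U : OddSet n => U.1.card = 2 * c' + 1), X U) * ∑ M, Y M).trace ≤
      Real.sqrt ((n.choose (2 * c' + 1) : ℝ) * (Fintype.card (PMatch n) : ℝ) / n *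
        ((∑ U ∈ univ.filter (fun U : OddSet n => U.1.card = 2 * c' + 1), (X U).trace) * ∑ M, (Y M).trace)) := by
  refine (trace_sum_mul_sum_le hn ht X Y fun U M _ hUM => by rw [hXY.2.2 U M hUM, trace_zero]).trans ?_
  apply Real.sqrt_le_sqrt
  refine mul_le_mul_of_nonneg_left ?_ (by positivity)
  exact mul_le_mul (sum_le_sum fun U _ => sum_sq_le_trace (hXY.1 U).1 (hXY.1 U).2)
    (sum_le_sum fun M _ => sum_sq_le_trace (hXY.2.1 M).1 (hXY.2.1 M).2)
    (sum_nonneg fun M _ => sum_nonneg fun p _ => sum_nonneg fun q _ => sq_nonneg _)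
    (sum_nonneg fun U _ => (hXY.1 U).1.trace_nonneg)

/-- **Global misalignment, density form.** For `n` even, `t = 2c'+1 ≤ n/2` and a tight-orthogonal psd rectangle `(X, Y)` of dimension `r ≥ 1`
with averaged operators `X̄ = E_{|U|=t} X_U`, `Ȳ = E_M Y_M` and trace densities `τ_X = E_{|U|=t} tr X_U / r`, `τ_Y = E_M tr Y_M / r`:
`tr(X̄ Ȳ)/r ≤ √(τ_X · τ_Y / n)` (trivially `≤ min(τ_X, τ_Y)`; for `r = 1` and 0/1 rectangles: `μν ≤ 1/n`).
[cite: BrouwerHaemers2012, Prop. 4.3.2 (PDF p. 83)] [cite: GodsilMeagher2015, §15.2] [cite: Rothvoss2017, §2 (PDF p. 6)] -/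
theorem avg_overlap_le {r c' : ℕ} (hr : 0 < r) (hn : Even n) (ht : 2 * (2 * c' + 1) ≤ n)
    {X : OddSet n → Matrix (Fin r) (Fin r) ℝ} {Y : PMatch n → Matrix (Fin r) (Fin r) ℝ} (hXY : IsPsdRect X Y) :
    ((∑ U ∈ univ.filter (fun U : OddSet n => U.1.card = 2 * c' + 1), X U) * ∑ M, Y M).trace /
        ((r : ℝ) * ((univ.filter (fun U : OddSet n => U.1.card = 2 * c' + 1)).card : ℝ) * (Fintype.card (PMatch n) : ℝ)) ≤
      Real.sqrt ((∑ U ∈ univ.filter (fun U : OddSet n => U.1.card = 2 * c' + 1), (X U).trace) /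
          ((r : ℝ) * ((univ.filter (fun U : OddSet n => U.1.card = 2 * c' + 1)).card : ℝ)) *
        ((∑ M, (Y M).trace) / ((r : ℝ) * (Fintype.card (PMatch n) : ℝ))) / n) := by
  have h := trace_sum_mul_sum_le_of_isPsdRect hn ht hXY
  have hT : (((univ.filter (fun U : OddSet n => U.1.card = 2 * c' + 1)).card : ℕ) : ℝ) = (n.choose (2 * c' + 1) : ℝ) := by
    exact_mod_cast card_tcuts_eq_choose (n := n) ⟨c', rfl⟩
  rw [hT]
  set Cn : ℝ := (n.choose (2 * c' + 1) : ℝ) with hCn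
  set PM : ℝ := (Fintype.card (PMatch n) : ℝ) with hPM
  have hCpos : 0 < Cn := by rw [hCn]; exact_mod_cast Nat.choose_pos (by omega)
  have hPMpos : 0 < PM := by rw [hPM]; exact_mod_cast card_pmatch_pos hn
  have hr' : (0 : ℝ) < r := by exact_mod_cast hr
  have hn' : (0 : ℝ) < n := by exact_mod_cast (show 0 < n by omega)
  have hD : 0 < (r : ℝ) * Cn * PM := by positivity
  calc ((∑ U ∈ univ.filter (fun U : OddSet n => U.1.card = 2 * c' + 1), X U) * ∑ M, Y M).trace / ((r : ℝ) * Cn * PM)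
      ≤ Real.sqrt (Cn * PM / n * ((∑ U ∈ univ.filter (fun U : OddSet n => U.1.card = 2 * c' + 1), (X U).trace) *
          ∑ M, (Y M).trace)) / ((r : ℝ) * Cn * PM) := div_le_div_of_nonneg_right h hD.le
    _ = _ := by
        rw [← Real.sqrt_sq hD.le, ← Real.sqrt_div' _ (sq_nonneg _)]
        congr 1
        field_simp

/-- **Strategies that are isotropic on average have density product `≤ 1/n`.** If, for a tight-orthogonal psd rectangle of dimension `r ≥ 1`
(`n` even, `t = 2c'+1 ≤ n/2`), the averaged operators are scalar — `Σ_{|U|=t} X_U = (α·#\{t-cuts\})·I`, `Σ_M Y_M = (β·|PM_n|)·I`, so that `α`, `β`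
are the trace densities — then `α·β ≤ 1/n`: the psd analogue of `μν ≤ 1/n` for tight-free rectangles. [cite: GodsilMeagher2015, §15.2] -/
theorem isotropic_densities_le {r c' : ℕ} (hr : 0 < r) (hn : Even n) (ht : 2 * (2 * c' + 1) ≤ n)
    {X : OddSet n → Matrix (Fin r) (Fin r) ℝ} {Y : PMatch n → Matrix (Fin r) (Fin r) ℝ} (hXY : IsPsdRect X Y) {α β : ℝ}
    (hX : ∑ U ∈ univ.filter (fun U : OddSet n => U.1.card = 2 * c' + 1), X U =
      (α * ((univ.filter (fun U : OddSet n => U.1.card = 2 * c' + 1)).card : ℝ)) • (1 : Matrix (Fin r) (Fin r) ℝ))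
    (hY : ∑ M, Y M = (β * (Fintype.card (PMatch n) : ℝ)) • (1 : Matrix (Fin r) (Fin r) ℝ)) :
    α * β ≤ 1 / n := by
  have h := trace_sum_mul_sum_le_of_isPsdRect hn ht hXY
  have hT : (((univ.filter (fun U : OddSet n => U.1.card = 2 * c' + 1)).card : ℕ) : ℝ) = (n.choose (2 * c' + 1) : ℝ) := by
    exact_mod_cast card_tcuts_eq_choose (n := n) ⟨c', rfl⟩
  rw [← trace_sum, ← trace_sum, hX, hY, hT] at h
  simp only [smul_mul_smul_comm, Matrix.one_mul, trace_smul, trace_one, Fintype.card_fin, smul_eq_mul] at h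
  set Cn : ℝ := (n.choose (2 * c' + 1) : ℝ) with hCn
  set PM : ℝ := (Fintype.card (PMatch n) : ℝ) with hPM
  have hCpos : 0 < Cn := by rw [hCn]; exact_mod_cast Nat.choose_pos (by omega)
  have hPMpos : 0 < PM := by rw [hPM]; exact_mod_cast card_pmatch_pos hn
  have hr' : (0 : ℝ) < r := by exact_mod_cast hr
  have hn' : (0 : ℝ) < n := by exact_mod_cast (show 0 < n by omega)
  by_cases hs : α * β ≤ 0
  · exact hs.trans (by positivity)
  push Not at hs
  -- `h : αC·βP·r ≤ √(C P / n · (αC r)(βP r))`; square it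
  have hD : 0 < Cn * PM * r := by positivity
  have hlhs : 0 ≤ α * Cn * (β * PM) * r := by nlinarith [mul_pos hs hD]
  have e1 : (α * Cn * (β * PM) * r) ^ 2 = (α * β) * (α * β) * (Cn * PM * r) ^ 2 := by ring
  have e2 : Cn * PM / n * (α * Cn * r * (β * PM * r)) = (α * β) / n * (Cn * PM * r) ^ 2 := by field_simp
  have h2 := (Real.le_sqrt hlhs (by rw [e2]; exact mul_nonneg (div_nonneg hs.le hn'.le) (sq_nonneg _))).1 h
  have h3 : (α * β) * (α * β) * (Cn * PM * r) ^ 2 ≤ (α * β) / n * (Cn * PM * r) ^ 2 := by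
    rw [← e1, ← e2]; exact h2
  have h4 : (α * β) * (α * β) ≤ (α * β) / n := le_of_mul_le_mul_right h3 (by positivity)
  rw [le_div_iff₀ hn'] at h4 ⊢
  nlinarith [h4, hs]

end Summit.PneNP.PneNP.Theorems.ChebyshevTracialDesignGlobalMisalignment

end
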